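import Mathlib.NumberTheory.Height.MvPolynomial
import Mathlib.NumberTheory.Height.NumberField
import Literature.NumberTheory.EllipticCurves.HeightsBaseChangeProofs
import HarnessLib

/-!
# Heights under morphisms of projective space with FIELD-UNIFORM constants
# (Silverman AEC Thm. VIII.5.6 in absolute form; [GenEll] Prop. 1.4 (i), (iii) for `ℙⁿ`)

Let `k` be a number field and `φ = (p_j)_j : ℙ^ι → ℙ^{ι'}` a morphism of degree `n` given by
homogeneous polynomials `p_j ∈ k[X_ι]` of degree `n` together with a Nullstellensatz certificate
`Σ_j q_{ij}·p_j = X_i^{m+n}` (so the `p_j` have no common zero). Mathlib (M. Stoll,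
`Mathlib.NumberTheory.Height.MvPolynomial`) proves, over ONE field `K` with an admissible family of
absolute values, `|logHeight (φ x) − n·logHeight x| ≤ C_K` with a constant `C_K` built from
`Height.mulHeightBound`. For statements about points of `ℙ^ι(ℚ̄) = ⋃_K ℙ^ι(K)` — bounded-discrepancy
classes of NORMALISED heights `h_K/[K:ℚ]` ([GenEll] Def. 1.2, Prop. 1.4) — one needs the constant
to be `≤ C·[K:ℚ]` with `C` depending on `φ` only. We PROVE this:

* `mulHeightBound_map_le` — for a family `p` over `k` and a finite extension `K/k`:
  `mulHeightBound (map p) ≤ T^{totalWeight K} · mulHeight_K (c)` for any tuple `c` over `k` with nonzero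
  entries listing the coefficients of the `p_j` and the entry `1`, where
  `T` bounds the number of monomials of each `p_j`; with the tree's base change
  `mulHeight (algebraMap k K ∘ c) = mulHeight c ^ [K:k]` (`NumberField.mulHeight_comp_algebraMap`,
  Silverman VIII.5.4 (b)) this is `≤ [K:ℚ]·(log T + h_k(c)/[k:ℚ])` in logarithm
  (`log_mulHeightBound_map_le`);
* `exists_abs_logHeight_eval_sub_le_finrank` — **Silverman, AEC Thm. VIII.5.6 / [GenEll] Prop. 1.4
  (i)+(iii) for projective space, absolute form**: there is `C = C(φ)` with
  `|logHeight_K (φ x) − n·logHeight_K x| ≤ C·[K:ℚ]` for every number field `K ⊇ k` and every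
  `x ∈ K^ι ∖ {0}`.

The integer-coefficient special case (`k = ℚ`, `ℓ¹`-bound) is `mulHeightBound_le_pow_totalWeight`
in `LambdaLineJHeight.lean` (same directory), used there for `j : ℙ¹_λ → ℙ¹_j`. abc-iut cell:
infrastructure for the heights bookkeeping of [GenEll] §1–§2 (Prop. 1.4; Thm. 2.1's Belyi maps are
morphisms `ℙ¹ → ℙ¹` over number fields); classical, no side taken on anything disputed.
-/

noncomputable section

open MvPolynomial Height Height.AdmissibleAbsValues Real NumberField

namespace Literature.NumberTheory.DiophantineGeometry

universe u

section Bound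

variable {k : Type*} [Field k] {ι ι' : Type*}

variable [Fintype ι'] [Nonempty ι'] {K : Type*} [Field K] [AdmissibleAbsValues K] [Algebra k K]

/-- **Stoll's constant over an extension is controlled by the height of the coefficients.** For a
family `p` of polynomials over `k`, each with at most `T ≥ 1` monomials, and any field `K ⊇ k` with
an admissible family of absolute values:
`mulHeightBound (map p) ≤ T^{totalWeight K} · mulHeight_K (c)` for any tuple `c` over `k` with nonzero
entries among which are `1` and every coefficient of every `p_j`.
(Archimedean `v`: `Σ_s v(c_s) ≤ T·max_s v(c_s)`; non-archimedean `v`: `max(max_s v(c_s), 1) ≤`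
the sup over the tuple, whose entry `1` absorbs the `max … 1`.) This is the local-coefficient step of
the proof of Silverman, AEC Thm. VIII.5.6, in Mathlib's normalisation.
[cite: SilvermanAEC2009, Thm VIII.5.6 (proof)] -/
theorem mulHeightBound_map_le (p : ι' → MvPolynomial ι k) {T : ℕ} (hT₁ : 1 ≤ T)
    (hT : ∀ j, (p j).support.card ≤ T) {κ : Type*} [Finite κ] (c₀ : κ → k) (hc₀ : ∀ o, c₀ o ≠ 0)
    (h₁ : ∃ o, c₀ o = 1) (hcoef : ∀ j, ∀ s ∈ (p j).support, ∃ o, c₀ o = coeff s (p j)) :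
    mulHeightBound (fun j => map (algebraMap k K) (p j)) ≤
      (T : ℝ) ^ totalWeight K * mulHeight (algebraMap k K ∘ c₀) := by
  classical
  set c : κ → K := algebraMap k K ∘ c₀ with hc
  obtain ⟨o₁, ho₁⟩ := h₁
  have hc_ne : ∀ o, c o ≠ 0 := fun o => by
    simpa [hc] using hc₀ o
  have hc0 : c ≠ 0 := fun h => hc_ne o₁ (congrFun h o₁)
  have hcoeff : ∀ j s, coeff s (map (algebraMap k K) (p j)) = algebraMap k K (coeff s (p j)) :=
    fun j s => coeff_map _ _ _
  have hsupp : ∀ j, (map (algebraMap k K) (p j)).support ⊆ (p j).support := fun j =>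
    support_map_subset _ _
  -- every absolute value of a coefficient is bounded by the sup over the tuple `c`
  have hle_sup : ∀ (v : AbsoluteValue K ℝ) (j : ι') (s : ι →₀ ℕ), s ∈ (p j).support →
      v (algebraMap k K (coeff s (p j))) ≤ ⨆ o, v (c o) := fun v j s hs => by
    obtain ⟨o, ho⟩ := hcoef j s hs
    exact Finite.le_ciSup_of_le (f := fun o => v (c o)) o (by simp [hc, ho])
  have hone_le_sup : ∀ v : AbsoluteValue K ℝ, 1 ≤ ⨆ o, v (c o) := fun v =>
    Finite.le_ciSup_of_le (f := fun o => v (c o)) o₁ (by simp [hc, ho₁])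
  have hsup_nonneg : ∀ v : AbsoluteValue K ℝ, 0 ≤ ⨆ o, v (c o) := fun v =>
    zero_le_one.trans (hone_le_sup v)
  -- archimedean factor
  have harch_term : ∀ v : AbsoluteValue K ℝ,
      (⨆ j, (AddMonoidAlgebra.coeff <| map (algebraMap k K) (p j)).sum fun _ a ↦ v a) ≤
        T * ⨆ o, v (c o) := fun v => by
    refine Real.iSup_le (fun j => ?_) (mul_nonneg (Nat.cast_nonneg _) (hsup_nonneg v))
    change ∑ s ∈ (map (algebraMap k K) (p j)).support, v (coeff s (map (algebraMap k K) (p j))) ≤ _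
    calc ∑ s ∈ (map (algebraMap k K) (p j)).support, v (coeff s (map (algebraMap k K) (p j)))
        ≤ ∑ s ∈ (p j).support, v (coeff s (map (algebraMap k K) (p j))) :=
          Finset.sum_le_sum_of_subset_of_nonneg (hsupp j) fun _ _ _ => v.nonneg _
      _ ≤ ∑ _s ∈ (p j).support, ⨆ o, v (c o) :=
          Finset.sum_le_sum fun s hs => by rw [hcoeff]; exact hle_sup v j s hs
      _ = (p j).support.card * ⨆ o, v (c o) := by rw [Finset.sum_const, nsmul_eq_mul]
      _ ≤ T * ⨆ o, v (c o) :=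
          mul_le_mul_of_nonneg_right (Nat.cast_le.mpr (hT j)) (hsup_nonneg v)
  have harch_nonneg : ∀ v : AbsoluteValue K ℝ,
      0 ≤ ⨆ j, (AddMonoidAlgebra.coeff <| map (algebraMap k K) (p j)).sum fun _ a ↦ v a :=
    fun v => Real.iSup_nonneg fun j => Finsupp.sum_nonneg' fun _ => v.nonneg _
  have harch : ((archAbsVal (K := K)).map fun v ↦
      ⨆ j, (AddMonoidAlgebra.coeff <| map (algebraMap k K) (p j)).sum fun _ a ↦ v a).prod ≤
      (T : ℝ) ^ totalWeight K * ((archAbsVal (K := K)).map fun v ↦ ⨆ o, v (c o)).prod := by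
    calc _ ≤ ((archAbsVal (K := K)).map fun v ↦ (T : ℝ) * ⨆ o, v (c o)).prod :=
          Multiset.prod_map_le_prod_map₀ _ _ (fun v _ => harch_nonneg v) fun v _ => harch_term v
      _ = _ := by rw [Multiset.prod_map_mul, Multiset.map_const', Multiset.prod_replicate]; rfl
  -- non-archimedean factor
  have hnon_term : ∀ v : nonarchAbsVal (K := K),
      (⨆ j, max (⨆ s : (map (algebraMap k K) (p j)).support,
        v.val (coeff s (map (algebraMap k K) (p j)))) 1) ≤ ⨆ o, v.val (c o) := fun v => by
    refine Real.iSup_le (fun j => max_le (Real.iSup_le (fun s => ?_) (hsup_nonneg _))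
      (hone_le_sup _)) (hsup_nonneg _)
    rw [hcoeff]
    exact hle_sup v.val j s (hsupp j s.2)
  have hnon_nonneg : ∀ v : nonarchAbsVal (K := K),
      0 ≤ (⨆ j, max (⨆ s : (map (algebraMap k K) (p j)).support,
        v.val (coeff s (map (algebraMap k K) (p j)))) 1) := fun v =>
    Real.iSup_nonneg fun j => le_max_of_le_right zero_le_one
  haveI : Nonempty κ := ⟨o₁⟩
  have hcfin : (fun v : nonarchAbsVal (K := K) => ⨆ o, v.val (c o)).HasFiniteMulSupport :=
    Function.HasFiniteMulSupport.iSup fun o => AdmissibleAbsValues.hasFiniteMulSupport (hc_ne o)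
  have hpfin : (fun v : nonarchAbsVal (K := K) => ⨆ j, max (⨆ s : (map (algebraMap k K) (p j)).support,
        v.val (coeff s (map (algebraMap k K) (p j)))) 1).HasFiniteMulSupport := by
    -- squeezed between `1` and a function with finite multiplicative support
    refine hcfin.subset fun v hv => ?_
    rw [Function.mem_mulSupport] at hv ⊢
    contrapose! hv
    refine le_antisymm (hv ▸ hnon_term v) ?_
    obtain ⟨j⟩ := (inferInstance : Nonempty ι')
    exact Finite.le_ciSup_of_le j (le_max_right _ _)
  have hnon : (∏ᶠ v : nonarchAbsVal (K := K), ⨆ j, max (⨆ s : (map (algebraMap k K) (p j)).support,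
        v.val (coeff s (map (algebraMap k K) (p j)))) 1) ≤ ∏ᶠ v : nonarchAbsVal (K := K),
          ⨆ o, v.val (c o) :=
    finprod_le_finprod hpfin hnon_nonneg hcfin hnon_term
  have hAc : 0 ≤ ((archAbsVal (K := K)).map fun v ↦ ⨆ o, v (c o)).prod :=
    Multiset.prod_map_nonneg fun v _ => hsup_nonneg v
  rw [mulHeightBound_eq, mulHeight_eq hc0]
  calc _ ≤ ((T : ℝ) ^ totalWeight K * ((archAbsVal (K := K)).map fun v ↦ ⨆ o, v (c o)).prod) *
        ∏ᶠ v : nonarchAbsVal (K := K), ⨆ o, v.val (c o) :=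
        mul_le_mul harch hnon (finprod_nonneg hnon_nonneg) (by positivity)
    _ = _ := mul_assoc _ _ _

end Bound

section NumberField

variable {k : Type u} [Field k] [NumberField k] {ι ι' : Type*} [Fintype ι']

/-- **The logarithmic form over number fields**: for `K ⊇ k` number fields,
`log (max (mulHeightBound (map p)) 1) ≤ [K:ℚ]·log T + [K:k]·logHeight_k c`, hence
`≤ [K:ℚ]·(log T + logHeight_k c)` — Stoll's constant grows at most linearly in `[K:ℚ]`
with a slope depending only on `p`. (Silverman VIII.5.6 proof + VIII.5.4 (b) base change, the
latter from the tree's `NumberField.mulHeight_comp_algebraMap`.)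
[cite: SilvermanAEC2009, Thm VIII.5.6 (proof)] -/
theorem log_mulHeightBound_map_le [Nonempty ι'] (p : ι' → MvPolynomial ι k) {T : ℕ}
    (hT₁ : 1 ≤ T) (hT : ∀ j, (p j).support.card ≤ T) {κ : Type*} [Finite κ] (c₀ : κ → k)
    (hc₀ : ∀ o, c₀ o ≠ 0) (h₁ : ∃ o, c₀ o = 1)
    (hcoef : ∀ j, ∀ s ∈ (p j).support, ∃ o, c₀ o = coeff s (p j))
    (K : Type u) [Field K] [NumberField K] [Algebra k K] :
    Real.log (max (mulHeightBound (fun j => map (algebraMap k K) (p j))) 1) ≤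
      Module.finrank ℚ K * (Real.log T + logHeight c₀) := by
  classical
  have hB := mulHeightBound_map_le (K := K) p hT₁ hT c₀ hc₀ h₁ hcoef
  rw [NumberField.mulHeight_comp_algebraMap] at hB
  have hT' : (1 : ℝ) ≤ T := by exact_mod_cast hT₁
  have hH : 1 ≤ mulHeight c₀ := one_le_mulHeight _
  have h1 : (1 : ℝ) ≤ (T : ℝ) ^ totalWeight K * mulHeight c₀ ^ Module.finrank k K :=
    one_le_mul_of_one_le_of_one_le (one_le_pow₀ hT') (one_le_pow₀ hH)
  have hdeg : (Module.finrank k K : ℝ) ≤ Module.finrank ℚ K := by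
    have := Module.finrank_mul_finrank ℚ k K
    have hk : 1 ≤ Module.finrank ℚ k := Module.finrank_pos
    exact_mod_cast (by nlinarith : Module.finrank k K ≤ Module.finrank ℚ K)
  calc Real.log (max (mulHeightBound (fun j => map (algebraMap k K) (p j))) 1)
      ≤ Real.log ((T : ℝ) ^ totalWeight K * mulHeight c₀ ^ Module.finrank k K) :=
        Real.log_le_log (by positivity) (max_le hB h1)
    _ = totalWeight K * Real.log T + Module.finrank k K * logHeight c₀ := by
        rw [Real.log_mul (by positivity) (by positivity), Real.log_pow, Real.log_pow,
          logHeight_eq_log_mulHeight]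
    _ ≤ Module.finrank ℚ K * Real.log T + Module.finrank ℚ K * logHeight c₀ := by
        rw [NumberField.totalWeight_eq_finrank]
        linarith [mul_le_mul_of_nonneg_right hdeg (logHeight_nonneg c₀)]
    _ = _ := by ring

/-- **Heights under a morphism of projective spaces, field-uniform form** (Silverman, AEC
Thm. VIII.5.6: `h(φ(P)) = d·h(P) + O(1)` on `ℙⁿ(ℚ̄)`; [GenEll] Prop. 1.4 (i), (iii) for `X = ℙ^ι`,
`φ^*𝒪(1) ≅ 𝒪(n)`). Let `p_j ∈ k[X_ι]` be homogeneous of degree `n` and `q_{ij}` homogeneous of degree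
`m` with `Σ_j q_{ij}·p_j = X_i^{m+n}` for all `i`. Then there is `C` (depending on `p, q` only) such
that for every number field `K ⊇ k` and every `x ∈ K^ι`:
`|logHeight_K (j ↦ p_j(x)) − n·logHeight_K x| ≤ C·[K:ℚ]`.
[cite: SilvermanAEC2009, Thm VIII.5.6] -/
theorem exists_abs_logHeight_eval_sub_le_finrank [Fintype ι] {n m : ℕ}
    (p : ι' → MvPolynomial ι k) (hp : ∀ j, (p j).IsHomogeneous n)
    (q : ι × ι' → MvPolynomial ι k) (hq : ∀ a, (q a).IsHomogeneous m)
    (hpq : ∀ i, ∑ j, q (i, j) * p j = X i ^ (m + n)) :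
    ∃ C : ℝ, ∀ (K : Type u) [Field K] [NumberField K] [Algebra k K] (x : ι → K),
      |logHeight (fun j => (map (algebraMap k K) (p j)).eval x) - n * logHeight x|
        ≤ C * Module.finrank ℚ K := by
  classical
  -- degenerate case: no target coordinates (then there are no source coordinates either)
  rcases isEmpty_or_nonempty ι' with hι' | hι'
  · have hι : IsEmpty ι := by
      by_contra h
      obtain ⟨i⟩ := not_isEmpty_iff.mp h
      have := hpq i
      simp only [Finset.univ_eq_empty, Finset.sum_empty] at this
      exact (pow_ne_zero _ (X_ne_zero (R := k) i)) this.symm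
    refine ⟨0, fun K _ _ _ x => ?_⟩
    rw [logHeight_eq_zero_of_subsingleton, logHeight_eq_zero_of_subsingleton]
    simp
  -- degenerate case: no source coordinates (`x` is the empty tuple, all `p_j(x)` are constants)
  rcases isEmpty_or_nonempty ι with hι | hι
  · refine ⟨logHeight (fun j => (p j).coeff 0), fun K _ _ _ x => ?_⟩
    have hx : logHeight x = 0 := logHeight_eq_zero_of_subsingleton x
    have heval : (fun j => (map (algebraMap k K) (p j)).eval x) =
        algebraMap k K ∘ (fun j => (p j).coeff 0) := by
      funext j
      conv_lhs => rw [eq_C_of_isEmpty (p j)]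
      simp [map_C, eval_C]
    rw [hx, mul_zero, sub_zero, heval, NumberField.logHeight_comp_algebraMap,
      abs_of_nonneg (mul_nonneg (Nat.cast_nonneg _) (logHeight_nonneg _))]
    have hdeg : (Module.finrank k K : ℝ) ≤ Module.finrank ℚ K := by
      have := Module.finrank_mul_finrank ℚ k K
      have hk : 1 ≤ Module.finrank ℚ k := Module.finrank_pos
      exact_mod_cast (by nlinarith : Module.finrank k K ≤ Module.finrank ℚ K)
    nlinarith [logHeight_nonneg (fun j => (p j).coeff 0)]
  haveI : Nonempty (ι × ι') := inferInstance
  -- monomial counts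
  set Tp : ℕ := max 1 (Finset.univ.sup fun j => (p j).support.card) with hTp
  set Tq : ℕ := max 1 (Finset.univ.sup fun a => (q a).support.card) with hTq
  have hTp₁ : 1 ≤ Tp := le_max_left _ _
  have hTq₁ : 1 ≤ Tq := le_max_left _ _
  have hTp' : ∀ j, (p j).support.card ≤ Tp := fun j =>
    (Finset.le_sup (f := fun j => (p j).support.card) (Finset.mem_univ j)).trans (le_max_right _ _)
  have hTq' : ∀ a, (q a).support.card ≤ Tq := fun a =>
    (Finset.le_sup (f := fun a => (q a).support.card) (Finset.mem_univ a)).trans (le_max_right _ _)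
  -- the coefficient tuples (with an extra entry `1`), as points of projective space over `k`
  let cp : Option (Σ j : ι', (p j).support) → k :=
    fun o => o.elim 1 fun js => coeff (js.2 : ι →₀ ℕ) (p js.1)
  let cq : Option (Σ a : ι × ι', (q a).support) → k :=
    fun o => o.elim 1 fun as => coeff (as.2 : ι →₀ ℕ) (q as.1)
  have hcp0 : ∀ o, cp o ≠ 0 := by
    rintro (_ | ⟨j, s⟩)
    · simp [cp]
    · simpa [cp] using mem_support_iff.mp s.2
  have hcq0 : ∀ o, cq o ≠ 0 := by
    rintro (_ | ⟨a, s⟩)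
    · simp [cq]
    · simpa [cq] using mem_support_iff.mp s.2
  have hcp1 : ∃ o, cp o = 1 := ⟨none, rfl⟩
  have hcq1 : ∃ o, cq o = 1 := ⟨none, rfl⟩
  have hcpc : ∀ j, ∀ s ∈ (p j).support, ∃ o, cp o = coeff s (p j) :=
    fun j s hs => ⟨some ⟨j, ⟨s, hs⟩⟩, rfl⟩
  have hcqc : ∀ a, ∀ s ∈ (q a).support, ∃ o, cq o = coeff s (q a) :=
    fun a s hs => ⟨some ⟨a, ⟨s, hs⟩⟩, rfl⟩
  refine ⟨Real.log Tp + logHeight cp +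
    (Real.log (Nat.card ι') + (Real.log Tq + logHeight cq)), fun K _ _ _ x => ?_⟩
  set pK : ι' → MvPolynomial ι K := fun j => map (algebraMap k K) (p j) with hpK
  set qK : ι × ι' → MvPolynomial ι K := fun a => map (algebraMap k K) (q a) with hqK
  have hpK' : ∀ j, (pK j).IsHomogeneous n := fun j => (hp j).map _
  have hqK' : ∀ a, (qK a).IsHomogeneous m := fun a => (hq a).map _
  have hcert : ∀ i, ∑ j, (qK (i, j)).eval x * (pK j).eval x = x i ^ (m + n) := by
    intro i
    have h := congrArg (eval₂Hom (algebraMap k K) x) (hpq i)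
    simp only [map_sum, map_mul, map_pow, coe_eval₂Hom, eval₂_X] at h
    simpa only [hpK, hqK, eval_map] using h
  have hd : (0 : ℝ) ≤ Module.finrank ℚ K := Nat.cast_nonneg _
  -- upper bound
  have hup := logHeight_eval_le hpK' x
  have hBp := log_mulHeightBound_map_le p hTp₁ hTp' cp hcp0 hcp1 hcpc K
  -- lower bound
  have hlow := logHeight_eval_ge hqK' pK hcert
  have hBq := log_mulHeightBound_map_le q hTq₁ hTq' cq hcq0 hcq1 hcqc K
  have hcard : Real.log ((Nat.card ι' : ℝ) ^ totalWeight K * max (mulHeightBound qK) 1) ≤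
      Module.finrank ℚ K * (Real.log (Nat.card ι') + (Real.log Tq + logHeight cq)) := by
    have hpos : 0 < Nat.card ι' := Nat.card_pos
    rw [Real.log_mul (by positivity) (by positivity), Real.log_pow,
      NumberField.totalWeight_eq_finrank]
    nlinarith [Real.log_natCast_nonneg (Nat.card ι')]
  rw [abs_le]
  constructor
  · nlinarith [logHeight_nonneg cp, Real.log_natCast_nonneg Tp]
  · nlinarith [logHeight_nonneg cq, Real.log_natCast_nonneg Tq,
      Real.log_natCast_nonneg (Nat.card ι')]

end NumberField

end Literature.NumberTheory.DiophantineGeometry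

end
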